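import Mathlib.Analysis.Convex.Deriv
import Mathlib.Analysis.SpecialFunctions.ImproperIntegrals
import Mathlib.Analysis.SpecialFunctions.Gamma.Basic
import Mathlib.Analysis.SpecialFunctions.Gaussian.GaussianIntegral
import Mathlib.MeasureTheory.Group.Integral
import HarnessLib

/-!
# One-sided tails of a log-concave weight `e^{-g}` below a point of negative slope

`Literature/Probability/Distributions/`; companion of the one-dimensional Brascamp–Lieb files
(`BrascampLiebOneDim.lean`, hypotheses in the same raw shape `g g₁ g₂ : ℝ → ℝ` with `HasDerivAt`).
Elementary, source-free calculus that every Laplace-type / log-concave tail estimate uses and that the tree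
lacked in citable form:

* `tangent_line_le_of_convexOn`: the supporting line of a convex `g` at a point `b` of differentiability,
  `g b + g'(b)·(u − b) ≤ g u` on the whole convexity set `D` (from Mathlib's secant-slope lemmas);
* `exp_neg_le_of_convexOn`: hence `e^{-g(u)} ≤ e^{-g(b)}·e^{-β(b-u)}` on `D` when `g'(b) = -β`;
* `setIntegral_mul_exp_neg_le_of_convexOn`: integrated against any weight `f ≥ 0` over any measurable `S ⊆ D`;
* `setIntegral_exp_neg_le_of_convexOn` (`f = 1`, `S ⊆ D ∩ (-∞, b)`, `β > 0`): `∫_S e^{-g} ≤ e^{-g(b)}/β`, and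
  `setIntegral_pow_mul_exp_neg_le_of_convexOn` (`f = (b-u)^n`): `∫_S (b-u)^n e^{-g} ≤ e^{-g(b)}·n!/β^{n+1}`;
* curvature floor on `[b, a]` with `g'(a) = 0` (`a` = the mode of `e^{-g}`): `ρ(a-b) ≤ -g'(b)` and
  `ρ(a-b)²/2 ≤ g(b) − g(a)` (`mul_sub_le_neg_deriv_of_le_deriv2`, `mul_sq_div_two_le_sub_of_le_deriv2`);
  curvature ceiling near `a`: `g(u) − g(a) ≤ Λ(u−a)²/2` (`sub_le_mul_sq_div_two_of_deriv2_le`);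
* the assembled LEFT-TAIL LEMMA `setIntegral_exp_neg_le_of_curvature_floor`:
  `∫_{S} e^{-g} ≤ e^{-g(a)}·e^{-ρ(a-b)²/2}/(ρ(a-b))` for `S ⊆ D ∩ (-∞, b)`, `b < a`.

This is ingredient P3/(4.4) of the Brascamp–Lieb ladder for the tilted laws `ν_k ∝ u^k Φ(u) du` of the
Jensen-polynomial moment method (consumer: `Literature/NumberTheory/LFunctions/XiTiltedPotential.lean`), stated
free of that application. No probability normalisation is performed here (divide by `Z = ∫ e^{-g}` downstream).

Sources (the statements are textbook facts; we cite where each is PRINTED, in the one-dimensional / localised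
form proved here): J. Peypouquet, *Convex Optimization in Normed Spaces* (Springer 2015), Prop. 3.10 (first-order
characterisation of convexity: `f(y) ≥ f(x) + ⟨∇f(x), y − x⟩`), Prop. 3.12 (strong convexity: the same with
`+ (α/2)‖x − y‖²`, and `⟨∇f(x) − ∇f(y), x − y⟩ ≥ α‖x − y‖²`), Lemma 1.30 (descent lemma:
`f(y) ≤ f(x) + ⟨∇f(x), y − x⟩ + (L/2)‖y − x‖²`) [Peypouquet2015]; M. Bagnoli, T. Bergstrom, Econ. Theory 26
(2005), Lemma 1, proof, inequality (2): for a log-concave density `f` increasing at `x`,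
`F(x) ≤ f(x)(f(x) − f(ℓ))/f′(x) ≤ f(x)²/f′(x)` — the mass form below [BagnoliBergstrom2005]; Gradshteyn–Ryzhik
3.351.3 (`∫₀^∞ xⁿe^{−μx}dx = n!μ^{−n−1}`) [GradshteynRyzhik2015]. No definitions.
-/

noncomputable section

open MeasureTheory Set Real
open scoped Nat

namespace Literature.Probability.Distributions

variable {D S : Set ℝ} {g : ℝ → ℝ} {b g' β : ℝ}

/-! ## 1. Supporting line and the pointwise exponential bound -/

/-- **Supporting line of a convex function.** If `g` is convex on `D` and differentiable at `b ∈ D` with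
derivative `g'`, then `g b + g'·(u − b) ≤ g u` for every `u ∈ D` (Peypouquet's Prop. 3.10 (i) ⇒ (ii), here on a
convex subset of `ℝ` and with differentiability at the base point only).
[cite: Peypouquet2015, Prop. 3.10 (ii)] -/
theorem tangent_line_le_of_convexOn (hg : ConvexOn ℝ D g) (hb : b ∈ D) (hd : HasDerivAt g g' b)
    {u : ℝ} (hu : u ∈ D) : g b + g' * (u - b) ≤ g u := by
  rcases lt_trichotomy u b with hub | rfl | hbu
  · have h := hg.slope_le_of_hasDerivAt hu hb hub hd
    rw [slope_def_field] at h
    have hpos : 0 < b - u := sub_pos.2 hub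
    have h' : g b - g u ≤ g' * (b - u) := (div_le_iff₀ hpos).1 h
    linarith
  · simp
  · have h := hg.le_slope_of_hasDerivAt hb hu hbu hd
    rw [slope_def_field] at h
    have hpos : 0 < u - b := sub_pos.2 hbu
    have h' : g' * (u - b) ≤ g u - g b := (le_div_iff₀ hpos).1 h
    linarith

/-- **Pointwise tail bound.** If `g` is convex on `D` and `g'(b) = −β` at `b ∈ D`, then
`e^{−g(u)} ≤ e^{−g(b)}·e^{−β(b−u)}` for every `u ∈ D` (both sides of `b`): the first-order inequality
exponentiated. [cite: Peypouquet2015, Prop. 3.10 (ii)] -/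
theorem exp_neg_le_of_convexOn (hg : ConvexOn ℝ D g) (hb : b ∈ D) (hd : HasDerivAt g (-β) b)
    {u : ℝ} (hu : u ∈ D) : exp (-g u) ≤ exp (-g b) * exp (-(β * (b - u))) := by
  rw [← Real.exp_add]
  apply Real.exp_le_exp.2
  have h := tangent_line_le_of_convexOn hg hb hd hu
  linarith

/-! ## 2. Integrated forms -/

/-- **Integrated tail bound, general weight.** If `g` is convex on `D`, `g'(b) = −β` at `b ∈ D`, `S ⊆ D` is
measurable, `f ≥ 0` on `S` and `f(u)e^{−β(b−u)}` is integrable on `S`, then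
`∫_S f e^{−g} ≤ e^{−g(b)} ∫_S f(u) e^{−β(b−u)} du`. (No integrability of the left side is assumed: a
non-integrable left side has integral `0`.) For `f = 1`, `S = (ℓ, b)` this is inequality (2) in the proof of
Bagnoli–Bergstrom's Lemma 1 (`F(b)·f′(b)/f(b) ≤ f(b) − f(ℓ)` for the log-concave density `f = e^{−g}`), here
integrated against a general weight. [cite: BagnoliBergstrom2005, Lemma 1 (proof, (2))] -/
theorem setIntegral_mul_exp_neg_le_of_convexOn (hg : ConvexOn ℝ D g) (hb : b ∈ D)
    (hd : HasDerivAt g (-β) b) (hS : S ⊆ D) (hSm : MeasurableSet S) {f : ℝ → ℝ}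
    (hf : ∀ u ∈ S, 0 ≤ f u) (hfi : IntegrableOn (fun u => f u * exp (-(β * (b - u)))) S) :
    ∫ u in S, f u * exp (-g u) ≤ exp (-g b) * ∫ u in S, f u * exp (-(β * (b - u))) := by
  rw [← integral_const_mul]
  have hpt : ∀ u ∈ S, f u * exp (-g u) ≤ exp (-g b) * (f u * exp (-(β * (b - u)))) := by
    intro u hu
    have h := exp_neg_le_of_convexOn hg hb hd (hS hu)
    calc f u * exp (-g u) ≤ f u * (exp (-g b) * exp (-(β * (b - u)))) :=
          mul_le_mul_of_nonneg_left h (hf u hu)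
      _ = exp (-g b) * (f u * exp (-(β * (b - u)))) := by ring
  by_cases hgi : IntegrableOn (fun u => f u * exp (-g u)) S
  · exact setIntegral_mono_on hgi (hfi.const_mul _) hSm hpt
  · rw [integral_undef hgi]
    exact setIntegral_nonneg hSm fun u hu =>
      mul_nonneg (exp_pos _).le (mul_nonneg (hf u hu) (exp_pos _).le)

/-- `∫_{u<b} (b−u)^n e^{−β(b−u)} du = n!/β^{n+1}` (`β > 0`; substitution `t = b − u` in Gradshteyn–Ryzhik
3.351.3, `∫₀^∞ tⁿe^{−βt}dt = n!β^{−n−1}`). [cite: GradshteynRyzhik2015, 3.351.3] -/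
theorem setIntegral_Iio_pow_mul_exp_neg (hβ : 0 < β) (n : ℕ) :
    ∫ u in Iio b, (b - u) ^ n * exp (-(β * (b - u))) = (n ! : ℝ) / β ^ (n + 1) := by
  have hmp : MeasurePreserving (fun u : ℝ => b - u) volume volume := Measure.measurePreserving_sub_left volume b
  have hme : MeasurableEmbedding (fun u : ℝ => b - u) := measurableEmbedding_subLeft b
  have hpre : (fun u : ℝ => b - u) ⁻¹' Ioi 0 = Iio b := by
    ext u; simp
  have h := hmp.setIntegral_preimage_emb hme (fun t => t ^ n * exp (-(β * t))) (Ioi 0)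
  rw [hpre] at h
  rw [h]
  have h2 := Real.integral_rpow_mul_exp_neg_mul_Ioi (a := ((n + 1 : ℕ) : ℝ)) (by positivity) hβ
  have e : ∀ t : ℝ, t ^ (((n + 1 : ℕ) : ℝ) - 1) = t ^ n := by
    intro t
    rw [show (((n + 1 : ℕ) : ℝ) - 1) = ((n : ℕ) : ℝ) by push_cast; ring, Real.rpow_natCast]
  simp_rw [e] at h2
  rw [h2, Real.rpow_natCast, show ((n + 1 : ℕ) : ℝ) = (n : ℝ) + 1 by push_cast; ring,
    Real.Gamma_nat_eq_factorial, one_div, inv_pow, inv_mul_eq_div]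

/-- `u ↦ (b−u)^n e^{−β(b−u)}` is integrable on `(−∞, b)` for `β > 0` (the integral 3.351.3 converges).
[cite: GradshteynRyzhik2015, 3.351.3] -/
theorem integrableOn_Iio_pow_mul_exp_neg (hβ : 0 < β) (n : ℕ) :
    IntegrableOn (fun u => (b - u) ^ n * exp (-(β * (b - u)))) (Iio b) := by
  have hmp : MeasurePreserving (fun u : ℝ => b - u) volume volume := Measure.measurePreserving_sub_left volume b
  have hme : MeasurableEmbedding (fun u : ℝ => b - u) := measurableEmbedding_subLeft b
  have hpre : (fun u : ℝ => b - u) ⁻¹' Ioi 0 = Iio b := by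
    ext u; simp
  have hI : IntegrableOn (fun t : ℝ => t ^ n * exp (-(β * t))) (Ioi 0) := by
    have hk : (-1 : ℝ) < (n : ℝ) := by
      have := Nat.cast_nonneg (α := ℝ) n
      linarith
    have h := integrableOn_rpow_mul_exp_neg_mul_rpow (s := (n : ℝ)) (p := 1) hk le_rfl hβ
    refine h.congr_fun (fun u _ => ?_) measurableSet_Ioi
    simp only [Real.rpow_natCast, Real.rpow_one, neg_mul]
  have h := (hmp.integrableOn_comp_preimage hme (f := fun t : ℝ => t ^ n * exp (-(β * t)))
    (s := Ioi 0)).2 hI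
  rw [hpre] at h
  exact h

/-- **Moment form of the tail bound.** If `g` is convex on `D`, `g'(b) = −β < 0` at `b ∈ D` and
`S ⊆ D ∩ (−∞, b)` is measurable, then `∫_S (b−u)^n e^{−g(u)} du ≤ e^{−g(b)}·n!/β^{n+1}` (Bagnoli–Bergstrom's
inequality (2) against the weight `(b−u)^n`, evaluated by 3.351.3). [cite: BagnoliBergstrom2005, Lemma 1 (proof, (2))] -/
theorem setIntegral_pow_mul_exp_neg_le_of_convexOn (hg : ConvexOn ℝ D g) (hb : b ∈ D)
    (hd : HasDerivAt g (-β) b) (hβ : 0 < β) (hS : S ⊆ D ∩ Iio b) (hSm : MeasurableSet S) (n : ℕ) :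
    ∫ u in S, (b - u) ^ n * exp (-g u) ≤ exp (-g b) * ((n ! : ℝ) / β ^ (n + 1)) := by
  have hSD : S ⊆ D := fun u hu => (hS hu).1
  have hSb : S ⊆ Iio b := fun u hu => (hS hu).2
  have hnn : ∀ u ∈ S, 0 ≤ (b - u) ^ n := fun u hu => pow_nonneg (sub_nonneg.2 (le_of_lt (hSb hu))) n
  have hI := integrableOn_Iio_pow_mul_exp_neg (b := b) hβ n
  calc ∫ u in S, (b - u) ^ n * exp (-g u)
      ≤ exp (-g b) * ∫ u in S, (b - u) ^ n * exp (-(β * (b - u))) :=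
        setIntegral_mul_exp_neg_le_of_convexOn hg hb hd hSD hSm hnn (hI.mono_set hSb)
    _ ≤ exp (-g b) * ∫ u in Iio b, (b - u) ^ n * exp (-(β * (b - u))) := by
        refine mul_le_mul_of_nonneg_left ?_ (exp_pos _).le
        refine setIntegral_mono_set hI ?_ (Filter.Eventually.of_forall hSb)
        exact ae_restrict_of_forall_mem measurableSet_Iio fun u hu =>
          mul_nonneg (pow_nonneg (sub_nonneg.2 (le_of_lt hu)) n) (exp_pos _).le
    _ = exp (-g b) * ((n ! : ℝ) / β ^ (n + 1)) := by rw [setIntegral_Iio_pow_mul_exp_neg hβ n]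

/-- **Mass form of the tail bound.** If `g` is convex on `D`, `g'(b) = −β < 0` at `b ∈ D` and
`S ⊆ D ∩ (−∞, b)` is measurable, then `∫_S e^{−g} ≤ e^{−g(b)}/β` — for the log-concave density `f = e^{−g}`
this is `F(b) ≤ f(b)²/f′(b)`, inequality (2) in the proof of Bagnoli–Bergstrom's Lemma 1 (the step behind their
Theorem 1: the c.d.f. of a log-concave density is log-concave). [cite: BagnoliBergstrom2005, Lemma 1 (proof, (2))] -/
theorem setIntegral_exp_neg_le_of_convexOn (hg : ConvexOn ℝ D g) (hb : b ∈ D)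
    (hd : HasDerivAt g (-β) b) (hβ : 0 < β) (hS : S ⊆ D ∩ Iio b) (hSm : MeasurableSet S) :
    ∫ u in S, exp (-g u) ≤ exp (-g b) / β := by
  have h := setIntegral_pow_mul_exp_neg_le_of_convexOn hg hb hd hβ hS hSm 0
  simpa [div_eq_mul_inv] using h

/-! ## 3. Curvature floor and ceiling around the mode -/

variable {g₁ g₂ : ℝ → ℝ} {a ρ Λ : ℝ}

/-- **Slope from a curvature floor (left of the mode).** If `g₁' = g₂ ≥ ρ` on `[b, a]` and `g₁(a) = 0`,
then `ρ(a − b) ≤ −g₁(b)` (Peypouquet's Prop. 3.12 (iv) ⇒ (iii) with `y = a`, `∇f(a) = 0`, in dimension one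
and localised to the interval). [cite: Peypouquet2015, Prop. 3.12 (iii)] -/
theorem mul_sub_le_neg_deriv_of_le_deriv2 (hba : b ≤ a)
    (hg₁ : ∀ x ∈ Icc b a, HasDerivAt g₁ (g₂ x) x) (hρ : ∀ x ∈ Icc b a, ρ ≤ g₂ x) (ha : g₁ a = 0) :
    ρ * (a - b) ≤ -g₁ b := by
  have hc : ContinuousOn g₁ (Icc b a) := fun x hx => (hg₁ x hx).continuousAt.continuousWithinAt
  have hdiff : DifferentiableOn ℝ g₁ (interior (Icc b a)) := by
    rw [interior_Icc]
    exact fun x hx => (hg₁ x (Ioo_subset_Icc_self hx)).differentiableAt.differentiableWithinAt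
  have hge : ∀ x ∈ interior (Icc b a), ρ ≤ deriv g₁ x := by
    rw [interior_Icc]
    intro x hx
    rw [(hg₁ x (Ioo_subset_Icc_self hx)).deriv]
    exact hρ x (Ioo_subset_Icc_self hx)
  have h := (convex_Icc b a).mul_sub_le_image_sub_of_le_deriv hc hdiff hge b (left_mem_Icc.2 hba) a
    (right_mem_Icc.2 hba) hba
  linarith

/-- **Slope from a curvature floor (right of the mode).** If `g₁' = g₂ ≥ ρ` on `[a, c]` and `g₁(a) = 0`,
then `ρ(c − a) ≤ g₁(c)` (Prop. 3.12 (iv) ⇒ (iii), one-dimensional, localised).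
[cite: Peypouquet2015, Prop. 3.12 (iii)] -/
theorem mul_sub_le_deriv_of_le_deriv2 {c : ℝ} (hac : a ≤ c)
    (hg₁ : ∀ x ∈ Icc a c, HasDerivAt g₁ (g₂ x) x) (hρ : ∀ x ∈ Icc a c, ρ ≤ g₂ x) (ha : g₁ a = 0) :
    ρ * (c - a) ≤ g₁ c := by
  have hc : ContinuousOn g₁ (Icc a c) := fun x hx => (hg₁ x hx).continuousAt.continuousWithinAt
  have hdiff : DifferentiableOn ℝ g₁ (interior (Icc a c)) := by
    rw [interior_Icc]
    exact fun x hx => (hg₁ x (Ioo_subset_Icc_self hx)).differentiableAt.differentiableWithinAt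
  have hge : ∀ x ∈ interior (Icc a c), ρ ≤ deriv g₁ x := by
    rw [interior_Icc]
    intro x hx
    rw [(hg₁ x (Ioo_subset_Icc_self hx)).deriv]
    exact hρ x (Ioo_subset_Icc_self hx)
  have h := (convex_Icc a c).mul_sub_le_image_sub_of_le_deriv hc hdiff hge a (left_mem_Icc.2 hac) c
    (right_mem_Icc.2 hac) hac
  linarith

/-- The derivative of `x ↦ ρ(x − a)²/2` is `ρ(x − a)` (plumbing). [folklore] -/
private theorem hasDerivAt_mul_sq_div_two (ρ a x : ℝ) :
    HasDerivAt (fun x => ρ * (x - a) ^ 2 / 2) (ρ * (x - a)) x := by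
  have h1 : HasDerivAt (fun x => x - a) 1 x := (hasDerivAt_id x).sub_const a
  have h : HasDerivAt (fun x => ρ * ((x - a) * (x - a)) / 2) (ρ * (1 * (x - a) + (x - a) * 1) / 2) x :=
    ((h1.mul h1).const_mul ρ).div_const 2
  have e1 : (fun x : ℝ => ρ * (x - a) ^ 2 / 2) = fun x => ρ * ((x - a) * (x - a)) / 2 := by
    funext y; ring
  rw [e1]
  convert h using 1
  ring

/-- **Drop from a curvature floor (left of the mode).** If `g' = g₁`, `g₁' = g₂ ≥ ρ` on `[b, a]` and
`g₁(a) = 0`, then `ρ(a − b)²/2 ≤ g(b) − g(a)` (Peypouquet's Prop. 3.12 (iv) ⇒ (ii) with `x = a`,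
`∇f(a) = 0`: `f(y) ≥ f(x) + ⟨∇f(x), y − x⟩ + (α/2)‖x − y‖²`, one-dimensional, localised to `[b, a]`).
[cite: Peypouquet2015, Prop. 3.12 (ii)] -/
theorem mul_sq_div_two_le_sub_of_le_deriv2 (hba : b ≤ a)
    (hg : ∀ x ∈ Icc b a, HasDerivAt g (g₁ x) x) (hg₁ : ∀ x ∈ Icc b a, HasDerivAt g₁ (g₂ x) x)
    (hρ : ∀ x ∈ Icc b a, ρ ≤ g₂ x) (ha : g₁ a = 0) :
    ρ * (a - b) ^ 2 / 2 ≤ g b - g a := by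
  -- `F(x) = g x − ρ(x − a)²/2` is antitone on `[b, a]`: `F' = g₁ x − ρ(x − a) ≤ 0` there
  have hFd : ∀ x ∈ Icc b a, HasDerivAt (fun x => g x - ρ * (x - a) ^ 2 / 2) (g₁ x - ρ * (x - a)) x :=
    fun x hx => (hg x hx).sub (hasDerivAt_mul_sq_div_two ρ a x)
  have hF' : ∀ x ∈ Icc b a, g₁ x - ρ * (x - a) ≤ 0 := by
    intro x hx
    have h := mul_sub_le_neg_deriv_of_le_deriv2 hx.2 (fun y hy => hg₁ y ⟨le_trans hx.1 hy.1, hy.2⟩)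
      (fun y hy => hρ y ⟨le_trans hx.1 hy.1, hy.2⟩) ha
    linarith
  have hc : ContinuousOn (fun x => g x - ρ * (x - a) ^ 2 / 2) (Icc b a) :=
    fun x hx => (hFd x hx).continuousAt.continuousWithinAt
  have hdiff : DifferentiableOn ℝ (fun x => g x - ρ * (x - a) ^ 2 / 2) (interior (Icc b a)) := by
    rw [interior_Icc]
    exact fun x hx => (hFd x (Ioo_subset_Icc_self hx)).differentiableAt.differentiableWithinAt
  have hle : ∀ x ∈ interior (Icc b a), deriv (fun x => g x - ρ * (x - a) ^ 2 / 2) x ≤ 0 := by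
    rw [interior_Icc]
    intro x hx
    rw [(hFd x (Ioo_subset_Icc_self hx)).deriv]
    exact hF' x (Ioo_subset_Icc_self hx)
  have hanti := antitoneOn_of_deriv_nonpos (convex_Icc b a) hc hdiff hle
  have h := hanti (left_mem_Icc.2 hba) (right_mem_Icc.2 hba) hba
  simp only [sub_self] at h
  nlinarith [h]

/-- **Drop from a curvature floor (right of the mode).** If `g' = g₁`, `g₁' = g₂ ≥ ρ` on `[a, c]` and
`g₁(a) = 0`, then `ρ(c − a)²/2 ≤ g(c) − g(a)` (Prop. 3.12 (iv) ⇒ (ii), one-dimensional, localised to `[a, c]`).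
[cite: Peypouquet2015, Prop. 3.12 (ii)] -/
theorem mul_sq_div_two_le_sub_of_le_deriv2_right {c : ℝ} (hac : a ≤ c)
    (hg : ∀ x ∈ Icc a c, HasDerivAt g (g₁ x) x) (hg₁ : ∀ x ∈ Icc a c, HasDerivAt g₁ (g₂ x) x)
    (hρ : ∀ x ∈ Icc a c, ρ ≤ g₂ x) (ha : g₁ a = 0) :
    ρ * (c - a) ^ 2 / 2 ≤ g c - g a := by
  -- `F(x) = g x − ρ(x − a)²/2` is monotone on `[a, c]`: `F' = g₁ x − ρ(x − a) ≥ 0` there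
  have hFd : ∀ x ∈ Icc a c, HasDerivAt (fun x => g x - ρ * (x - a) ^ 2 / 2) (g₁ x - ρ * (x - a)) x :=
    fun x hx => (hg x hx).sub (hasDerivAt_mul_sq_div_two ρ a x)
  have hF' : ∀ x ∈ Icc a c, 0 ≤ g₁ x - ρ * (x - a) := by
    intro x hx
    have h := mul_sub_le_deriv_of_le_deriv2 hx.1 (fun y hy => hg₁ y ⟨hy.1, le_trans hy.2 hx.2⟩)
      (fun y hy => hρ y ⟨hy.1, le_trans hy.2 hx.2⟩) ha
    linarith
  have hc : ContinuousOn (fun x => g x - ρ * (x - a) ^ 2 / 2) (Icc a c) :=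
    fun x hx => (hFd x hx).continuousAt.continuousWithinAt
  have hdiff : DifferentiableOn ℝ (fun x => g x - ρ * (x - a) ^ 2 / 2) (interior (Icc a c)) := by
    rw [interior_Icc]
    exact fun x hx => (hFd x (Ioo_subset_Icc_self hx)).differentiableAt.differentiableWithinAt
  have hle : ∀ x ∈ interior (Icc a c), 0 ≤ deriv (fun x => g x - ρ * (x - a) ^ 2 / 2) x := by
    rw [interior_Icc]
    intro x hx
    rw [(hFd x (Ioo_subset_Icc_self hx)).deriv]
    exact hF' x (Ioo_subset_Icc_self hx)
  have hmono := monotoneOn_of_deriv_nonneg (convex_Icc a c) hc hdiff hle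
  have h := hmono (left_mem_Icc.2 hac) (right_mem_Icc.2 hac) hac
  simp only [sub_self] at h
  nlinarith [h]

/-- **Rise from a curvature ceiling.** If `g' = g₁`, `g₁' = g₂ ≤ Λ` on `[α, γ]` and `g₁(a) = 0` for some
`a ∈ [α, γ]`, then `g(u) − g(a) ≤ Λ(u − a)²/2` for every `u ∈ [α, γ]` — the descent lemma
`f(y) ≤ f(x) + ⟨∇f(x), y − x⟩ + (L/2)‖y − x‖²` at the critical point `x = a`, in dimension one with the one-sided
hypothesis `g'' ≤ Λ` (proved by applying the floor lemmas to `−g`). [cite: Peypouquet2015, Lemma 1.30] -/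
theorem sub_le_mul_sq_div_two_of_deriv2_le {α γ : ℝ} (ha : a ∈ Icc α γ)
    (hg : ∀ x ∈ Icc α γ, HasDerivAt g (g₁ x) x) (hg₁ : ∀ x ∈ Icc α γ, HasDerivAt g₁ (g₂ x) x)
    (hΛ : ∀ x ∈ Icc α γ, g₂ x ≤ Λ) (ha0 : g₁ a = 0) {u : ℝ} (hu : u ∈ Icc α γ) :
    g u - g a ≤ Λ * (u - a) ^ 2 / 2 := by
  rcases le_total u a with hua | hau
  · have hsub : Icc u a ⊆ Icc α γ := Icc_subset_Icc hu.1 ha.2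
    have h := mul_sq_div_two_le_sub_of_le_deriv2 (g := fun x => -g x) (g₁ := fun x => -g₁ x)
      (g₂ := fun x => -g₂ x) (ρ := -Λ) hua (fun x hx => (hg x (hsub hx)).neg)
      (fun x hx => (hg₁ x (hsub hx)).neg) (fun x hx => neg_le_neg (hΛ x (hsub hx))) (by simp [ha0])
    have e : (a - u) ^ 2 = (u - a) ^ 2 := by ring
    rw [e] at h
    linarith
  · have hsub : Icc a u ⊆ Icc α γ := Icc_subset_Icc ha.1 hu.2
    have h := mul_sq_div_two_le_sub_of_le_deriv2_right (g := fun x => -g x) (g₁ := fun x => -g₁ x)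
      (g₂ := fun x => -g₂ x) (ρ := -Λ) hau (fun x hx => (hg x (hsub hx)).neg)
      (fun x hx => (hg₁ x (hsub hx)).neg) (fun x hx => neg_le_neg (hΛ x (hsub hx))) (by simp [ha0])
    linarith

/-! ## 4. The assembled left-tail lemma -/

/-- **Left tail of a log-concave weight below the bulk.** Let `g` be convex on `D` with `[b, a] ⊆ D`,
`b < a`, `g' = g₁` and `g₁' = g₂ ≥ ρ > 0` on `[b, a]`, `g₁(a) = 0` (`a` is the mode of `e^{−g}`). Then for
every measurable `S ⊆ D ∩ (−∞, b)`:
`∫_S e^{−g} ≤ e^{−g(a)} · e^{−ρ(a−b)²/2} / (ρ(a−b))`.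
(Divide by `∫_D e^{−g} ≥ e^{−g(a)}·G` to get the tail PROBABILITY `≤ e^{−ρτ²/2}/(ρτG)`, `τ = a − b`.) Assembled
from Bagnoli–Bergstrom's inequality (2) and the strong-convexity inequalities of Prop. 3.12.
[cite: BagnoliBergstrom2005, Lemma 1 (proof, (2))] -/
theorem setIntegral_exp_neg_le_of_curvature_floor (hba : b < a) (hρ0 : 0 < ρ) (hg : ConvexOn ℝ D g)
    (hsub : Icc b a ⊆ D) (hgd : ∀ x ∈ Icc b a, HasDerivAt g (g₁ x) x)
    (hg₁ : ∀ x ∈ Icc b a, HasDerivAt g₁ (g₂ x) x) (hρ : ∀ x ∈ Icc b a, ρ ≤ g₂ x) (ha : g₁ a = 0)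
    (hS : S ⊆ D ∩ Iio b) (hSm : MeasurableSet S) :
    ∫ u in S, exp (-g u) ≤ exp (-g a) * exp (-(ρ * (a - b) ^ 2 / 2)) / (ρ * (a - b)) := by
  have hb : b ∈ D := hsub (left_mem_Icc.2 hba.le)
  have hslope := mul_sub_le_neg_deriv_of_le_deriv2 hba.le hg₁ hρ ha
  have hdrop := mul_sq_div_two_le_sub_of_le_deriv2 hba.le hgd hg₁ hρ ha
  have hβ : 0 < -g₁ b := lt_of_lt_of_le (mul_pos hρ0 (sub_pos.2 hba)) hslope
  have hd : HasDerivAt g (-(-g₁ b)) b := by rw [neg_neg]; exact hgd b (left_mem_Icc.2 hba.le)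
  have h1 := setIntegral_exp_neg_le_of_convexOn hg hb hd hβ hS hSm
  have h2 : exp (-g b) ≤ exp (-g a) * exp (-(ρ * (a - b) ^ 2 / 2)) := by
    rw [← Real.exp_add]
    exact Real.exp_le_exp.2 (by linarith)
  have hρτ : 0 < ρ * (a - b) := mul_pos hρ0 (sub_pos.2 hba)
  calc ∫ u in S, exp (-g u) ≤ exp (-g b) / (-g₁ b) := h1
    _ ≤ exp (-g a) * exp (-(ρ * (a - b) ^ 2 / 2)) / (-g₁ b) :=
        div_le_div_of_nonneg_right h2 hβ.le
    _ ≤ exp (-g a) * exp (-(ρ * (a - b) ^ 2 / 2)) / (ρ * (a - b)) :=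
        div_le_div_of_nonneg_left (by positivity) hρτ hslope

/-- **Left-tail moments below the bulk.** Under the hypotheses of
`setIntegral_exp_neg_le_of_curvature_floor`, for every `n`:
`∫_S (b−u)^n e^{−g(u)} du ≤ e^{−g(a)} · e^{−ρ(a−b)²/2} · n!/(ρ(a−b))^{n+1}`.
[cite: BagnoliBergstrom2005, Lemma 1 (proof, (2))] -/
theorem setIntegral_pow_mul_exp_neg_le_of_curvature_floor (hba : b < a) (hρ0 : 0 < ρ)
    (hg : ConvexOn ℝ D g) (hsub : Icc b a ⊆ D) (hgd : ∀ x ∈ Icc b a, HasDerivAt g (g₁ x) x)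
    (hg₁ : ∀ x ∈ Icc b a, HasDerivAt g₁ (g₂ x) x) (hρ : ∀ x ∈ Icc b a, ρ ≤ g₂ x) (ha : g₁ a = 0)
    (hS : S ⊆ D ∩ Iio b) (hSm : MeasurableSet S) (n : ℕ) :
    ∫ u in S, (b - u) ^ n * exp (-g u) ≤
      exp (-g a) * exp (-(ρ * (a - b) ^ 2 / 2)) * ((n ! : ℝ) / (ρ * (a - b)) ^ (n + 1)) := by
  have hb : b ∈ D := hsub (left_mem_Icc.2 hba.le)
  have hslope := mul_sub_le_neg_deriv_of_le_deriv2 hba.le hg₁ hρ ha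
  have hdrop := mul_sq_div_two_le_sub_of_le_deriv2 hba.le hgd hg₁ hρ ha
  have hρτ : 0 < ρ * (a - b) := mul_pos hρ0 (sub_pos.2 hba)
  have hβ : 0 < -g₁ b := lt_of_lt_of_le hρτ hslope
  have hd : HasDerivAt g (-(-g₁ b)) b := by rw [neg_neg]; exact hgd b (left_mem_Icc.2 hba.le)
  have h1 := setIntegral_pow_mul_exp_neg_le_of_convexOn hg hb hd hβ hS hSm n
  have h2 : exp (-g b) ≤ exp (-g a) * exp (-(ρ * (a - b) ^ 2 / 2)) := by
    rw [← Real.exp_add]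
    exact Real.exp_le_exp.2 (by linarith)
  have h3 : (n ! : ℝ) / (-g₁ b) ^ (n + 1) ≤ (n ! : ℝ) / (ρ * (a - b)) ^ (n + 1) :=
    div_le_div_of_nonneg_left (by positivity) (pow_pos hρτ _)
      (pow_le_pow_left₀ hρτ.le hslope _)
  calc ∫ u in S, (b - u) ^ n * exp (-g u) ≤ exp (-g b) * ((n ! : ℝ) / (-g₁ b) ^ (n + 1)) := h1
    _ ≤ exp (-g a) * exp (-(ρ * (a - b) ^ 2 / 2)) * ((n ! : ℝ) / (ρ * (a - b)) ^ (n + 1)) :=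
        mul_le_mul h2 h3 (by positivity) (by positivity)

/-! ## 5. Shifted moments `(c + (b − u))^l` (the left pieces of an un-conditioning argument) -/

/-- `∫_{u<b} (c + (b−u))^l e^{−β(b−u)} du = Σ_{m ≤ l} c^m·(l−m)!/β^{l−m+1}·C(l,m)` (`β > 0`; binomial expansion and
3.351.3 term by term). [cite: GradshteynRyzhik2015, 3.351.3] -/
theorem setIntegral_Iio_add_sub_pow_mul_exp_neg (hβ : 0 < β) (c : ℝ) (l : ℕ) :
    ∫ u in Iio b, (c + (b - u)) ^ l * exp (-(β * (b - u))) =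
      ∑ m ∈ Finset.range (l + 1), c ^ m * ((((l - m) ! : ℕ) : ℝ) / β ^ (l - m + 1)) * (l.choose m : ℝ) := by
  have hterm : ∀ m ∈ Finset.range (l + 1), IntegrableOn
      (fun u => c ^ m * ((b - u) ^ (l - m) * exp (-(β * (b - u)))) * (l.choose m : ℝ)) (Iio b) := by
    intro m _
    exact ((integrableOn_Iio_pow_mul_exp_neg (b := b) hβ (l - m)).const_mul (c ^ m)).mul_const _
  have hexp : ∀ u, (c + (b - u)) ^ l * exp (-(β * (b - u))) =
      ∑ m ∈ Finset.range (l + 1), c ^ m * ((b - u) ^ (l - m) * exp (-(β * (b - u)))) * (l.choose m : ℝ) := by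
    intro u
    rw [add_pow, Finset.sum_mul]
    refine Finset.sum_congr rfl fun m _ => ?_
    ring
  simp_rw [hexp]
  rw [integral_finsetSum _ hterm]
  refine Finset.sum_congr rfl fun m _ => ?_
  rw [integral_mul_const, integral_const_mul, setIntegral_Iio_pow_mul_exp_neg hβ (l - m)]

/-- `u ↦ (c + (b−u))^l e^{−β(b−u)}` is integrable on `(−∞, b)` for `β > 0`. [cite: GradshteynRyzhik2015, 3.351.3] -/
theorem integrableOn_Iio_add_sub_pow_mul_exp_neg (hβ : 0 < β) (c : ℝ) (l : ℕ) :
    IntegrableOn (fun u => (c + (b - u)) ^ l * exp (-(β * (b - u)))) (Iio b) := by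
  have hterm : ∀ m ∈ Finset.range (l + 1), IntegrableOn
      (fun u => c ^ m * ((b - u) ^ (l - m) * exp (-(β * (b - u)))) * (l.choose m : ℝ)) (Iio b) := by
    intro m _
    exact ((integrableOn_Iio_pow_mul_exp_neg (b := b) hβ (l - m)).const_mul (c ^ m)).mul_const _
  have h : IntegrableOn (fun u => ∑ m ∈ Finset.range (l + 1),
      c ^ m * ((b - u) ^ (l - m) * exp (-(β * (b - u)))) * (l.choose m : ℝ)) (Iio b) :=
    integrable_finsetSum (Finset.range (l + 1)) hterm
  refine h.congr_fun (fun u _ => ?_) measurableSet_Iio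
  rw [add_pow, Finset.sum_mul]
  refine Finset.sum_congr rfl fun m _ => ?_
  ring

/-- **Shifted-moment form of the tail bound.** If `g` is convex on `D`, `g'(b) = −β < 0` at `b ∈ D`, `c ≥ 0` and
`S ⊆ D ∩ (−∞, b)` is measurable, then
`∫_S (c + (b−u))^l e^{−g(u)} du ≤ e^{−g(b)} · Σ_{m ≤ l} c^m (l−m)!/β^{l−m+1} C(l,m)`.
[cite: BagnoliBergstrom2005, Lemma 1 (proof, (2))] -/
theorem setIntegral_add_sub_pow_mul_exp_neg_le_of_convexOn (hg : ConvexOn ℝ D g) (hb : b ∈ D)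
    (hd : HasDerivAt g (-β) b) (hβ : 0 < β) {c : ℝ} (hc : 0 ≤ c) (hS : S ⊆ D ∩ Iio b)
    (hSm : MeasurableSet S) (l : ℕ) :
    ∫ u in S, (c + (b - u)) ^ l * exp (-g u) ≤
      exp (-g b) * ∑ m ∈ Finset.range (l + 1), c ^ m * ((((l - m) ! : ℕ) : ℝ) / β ^ (l - m + 1)) * (l.choose m : ℝ) := by
  have hSD : S ⊆ D := fun u hu => (hS hu).1
  have hSb : S ⊆ Iio b := fun u hu => (hS hu).2
  have hnn : ∀ u ∈ S, 0 ≤ (c + (b - u)) ^ l := fun u hu =>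
    pow_nonneg (add_nonneg hc (sub_nonneg.2 (le_of_lt (hSb hu)))) l
  have hI := integrableOn_Iio_add_sub_pow_mul_exp_neg (b := b) hβ c l
  calc ∫ u in S, (c + (b - u)) ^ l * exp (-g u)
      ≤ exp (-g b) * ∫ u in S, (c + (b - u)) ^ l * exp (-(β * (b - u))) :=
        setIntegral_mul_exp_neg_le_of_convexOn hg hb hd hSD hSm hnn (hI.mono_set hSb)
    _ ≤ exp (-g b) * ∫ u in Iio b, (c + (b - u)) ^ l * exp (-(β * (b - u))) := by
        refine mul_le_mul_of_nonneg_left ?_ (exp_pos _).le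
        refine setIntegral_mono_set hI ?_ (Filter.Eventually.of_forall hSb)
        exact ae_restrict_of_forall_mem measurableSet_Iio fun u hu =>
          mul_nonneg (pow_nonneg (add_nonneg hc (sub_nonneg.2 (le_of_lt hu))) l) (exp_pos _).le
    _ = _ := by rw [setIntegral_Iio_add_sub_pow_mul_exp_neg hβ c l]

/-- **Shifted left-tail moments below the bulk.** Under the hypotheses of `setIntegral_exp_neg_le_of_curvature_floor`
and `c ≥ 0`: `∫_S (c + (b−u))^l e^{−g(u)} du ≤ e^{−g(a)}·e^{−ρ(a−b)²/2}·Σ_{m ≤ l} c^m (l−m)!/(ρ(a−b))^{l−m+1} C(l,m)`.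
[cite: BagnoliBergstrom2005, Lemma 1 (proof, (2))] -/
theorem setIntegral_add_sub_pow_mul_exp_neg_le_of_curvature_floor (hba : b < a) (hρ0 : 0 < ρ)
    (hg : ConvexOn ℝ D g) (hsub : Icc b a ⊆ D) (hgd : ∀ x ∈ Icc b a, HasDerivAt g (g₁ x) x)
    (hg₁ : ∀ x ∈ Icc b a, HasDerivAt g₁ (g₂ x) x) (hρ : ∀ x ∈ Icc b a, ρ ≤ g₂ x) (ha : g₁ a = 0)
    {c : ℝ} (hc : 0 ≤ c) (hS : S ⊆ D ∩ Iio b) (hSm : MeasurableSet S) (l : ℕ) :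
    ∫ u in S, (c + (b - u)) ^ l * exp (-g u) ≤
      exp (-g a) * exp (-(ρ * (a - b) ^ 2 / 2)) *
        ∑ m ∈ Finset.range (l + 1), c ^ m * ((((l - m) ! : ℕ) : ℝ) / (ρ * (a - b)) ^ (l - m + 1)) * (l.choose m : ℝ) := by
  have hb : b ∈ D := hsub (left_mem_Icc.2 hba.le)
  have hslope := mul_sub_le_neg_deriv_of_le_deriv2 hba.le hg₁ hρ ha
  have hdrop := mul_sq_div_two_le_sub_of_le_deriv2 hba.le hgd hg₁ hρ ha
  have hρτ : 0 < ρ * (a - b) := mul_pos hρ0 (sub_pos.2 hba)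
  have hβ : 0 < -g₁ b := lt_of_lt_of_le hρτ hslope
  have hd : HasDerivAt g (-(-g₁ b)) b := by rw [neg_neg]; exact hgd b (left_mem_Icc.2 hba.le)
  have h1 := setIntegral_add_sub_pow_mul_exp_neg_le_of_convexOn hg hb hd hβ hc hS hSm l
  have h2 : exp (-g b) ≤ exp (-g a) * exp (-(ρ * (a - b) ^ 2 / 2)) := by
    rw [← Real.exp_add]
    exact Real.exp_le_exp.2 (by linarith)
  have hterm : ∀ m ∈ Finset.range (l + 1),
      c ^ m * ((((l - m) ! : ℕ) : ℝ) / (-g₁ b) ^ (l - m + 1)) * (l.choose m : ℝ) ≤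
        c ^ m * ((((l - m) ! : ℕ) : ℝ) / (ρ * (a - b)) ^ (l - m + 1)) * (l.choose m : ℝ) := by
    intro m _
    refine mul_le_mul_of_nonneg_right (mul_le_mul_of_nonneg_left ?_ (pow_nonneg hc m)) (Nat.cast_nonneg _)
    exact div_le_div_of_nonneg_left (by positivity) (pow_pos hρτ _) (pow_le_pow_left₀ hρτ.le hslope _)
  have h3 := Finset.sum_le_sum hterm
  have hsum0 : 0 ≤ ∑ m ∈ Finset.range (l + 1),
      c ^ m * ((((l - m) ! : ℕ) : ℝ) / (ρ * (a - b)) ^ (l - m + 1)) * (l.choose m : ℝ) :=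
    Finset.sum_nonneg fun m _ => by positivity
  calc ∫ u in S, (c + (b - u)) ^ l * exp (-g u)
      ≤ exp (-g b) * ∑ m ∈ Finset.range (l + 1),
          c ^ m * ((((l - m) ! : ℕ) : ℝ) / (-g₁ b) ^ (l - m + 1)) * (l.choose m : ℝ) := h1
    _ ≤ exp (-g b) * ∑ m ∈ Finset.range (l + 1),
          c ^ m * ((((l - m) ! : ℕ) : ℝ) / (ρ * (a - b)) ^ (l - m + 1)) * (l.choose m : ℝ) :=
        mul_le_mul_of_nonneg_left h3 (exp_pos _).le
    _ ≤ _ := mul_le_mul_of_nonneg_right h2 hsum0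

end Literature.Probability.Distributions

end
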